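import Literature.MathematicalPhysics.QuantumLattice.LiebRobinsonBoundProofs
import Literature.MathematicalPhysics.QuantumLattice.LTQO
import Literature.MathematicalPhysics.QuantumLattice.LatticeToriProofs
import HarnessLib

/-!
# The Lieb–Robinson bound on decorated tori: a ball against the outside of a larger ball

Twelfth file of the formalisation of the Michalakis–Zwolak stability theorem (hubbard.S19). The
abstract finite-volume Lieb–Robinson bound `norm_comm_heisenbergEvolution_le_exp`
(`LiebRobinsonBoundProofs`) is stated for an arbitrary integer grading of regions satisfying two
axioms; here the grading is instantiated on the decorated torus `(ℤ/L)^d × κ` of MZ13 §2 for the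
geometry that the stability proof uses throughout (MZ13 §5.1 Lemma 1 (iv), §5.2 Lemma 2, §6): an
observable on the ball `B_x(r)` against observables supported outside `B_x(r + ℓ)`, for a
finite-range interaction (`Φ(Z) = 0` if `diam Z > r₀`). With `ρ_x(Z) = max_{z∈Z} dist(x,z)` the
grading is `Z ↦ ⌊(r + ℓ + 1 − ρ_x(Z))/(r₀ + 1)⌋`: positive grade forces `Z ⊆ B_x(r+ℓ)`
(`disjoint_of_grading_pos`), a term of diameter `≤ r₀` meeting `Z` has grade `≥ grade(Z) − 1`
(`grading_le_grading_add_one`, torus triangle inequality), and `B_x(r)` has grade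
`≥ ⌊(ℓ+1)/(r₀+1)⌋` (`div_le_grading_cellBall`). The result
(`norm_comm_heisenbergEvolution_ball_le`):
`‖[τ_t(A), B]‖ ≤ 2‖A‖‖B‖ (|B_x(r)|/V) exp(−μ⌊(ℓ+1)/(r₀+1)⌋ + 2e^μ V J|t|)` for every `μ ≥ 0`.
No definitions, no named facts (theorems only). [folklore]
-/

noncomputable section

open Matrix Complex NormedSpace MeasureTheory Finset
open scoped Matrix.Norms.L2Operator

namespace Literature.MathematicalPhysics.QuantumLattice

open Literature.Probability.LatticeModels

variable {d L : ℕ} [NeZero L] {κ : Type*} [Fintype κ] [DecidableEq κ] {q : ℕ}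

/-! ### Radius of a region from a centre -/

omit [NeZero L] [Fintype κ] [DecidableEq κ] in
/-- Every point of `Z` is within `ρ_x(Z) = max_{z ∈ Z} dist(x, z)` of `x`. [folklore] -/
theorem torusDist_le_sup_of_mem (x : TorusSite d L) {Z : Finset (TorusSite d L × κ)}
    {z : TorusSite d L × κ} (hz : z ∈ Z) :
    torusDist x z.1 ≤ Z.sup fun z => torusDist x z.1 :=
  Finset.le_sup (f := fun z : TorusSite d L × κ => torusDist x z.1) hz

omit [DecidableEq κ] in
/-- A region of radius `≤ R` from `x` lies in the cell ball of radius `R`. [folklore] -/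
theorem subset_cellBall_of_sup_le (x : TorusSite d L) {Z : Finset (TorusSite d L × κ)} {R : ℕ}
    (h : (Z.sup fun z => torusDist x z.1) ≤ R) : Z ⊆ cellBall x R := fun _ hz =>
  mem_cellBall_iff.2 ((torusDist_le_sup_of_mem x hz).trans h)

omit [DecidableEq κ] in
/-- The cell ball of radius `r` has radius `≤ r` from its centre. [folklore] -/
theorem sup_torusDist_cellBall_le (x : TorusSite d L) (r : ℕ) :
    ((cellBall x r : Finset (TorusSite d L × κ)).sup fun z => torusDist x z.1) ≤ r :=
  Finset.sup_le fun _ hz => mem_cellBall_iff.1 hz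

omit [NeZero L] [Fintype κ] [DecidableEq κ] in
/-- Two points of a region are within its diameter. [folklore] -/
theorem torusDist_le_torusDiam {Z : Finset (TorusSite d L × κ)} {a b : TorusSite d L × κ}
    (ha : a ∈ Z) (hb : b ∈ Z) : torusDist a.1 b.1 ≤ torusDiam Z :=
  (Finset.le_sup (f := fun y : TorusSite d L × κ => torusDist a.1 y.1) hb).trans
    (Finset.le_sup (f := fun x : TorusSite d L × κ => Z.sup fun y => torusDist x.1 y.1) ha)

omit [Fintype κ] [DecidableEq κ] in
/-- A region meeting `Z` has radius at most `ρ_x(Z) + diam`. [folklore] -/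
theorem sup_torusDist_le_of_not_disjoint (x : TorusSite d L) {Z Z' : Finset (TorusSite d L × κ)}
    (h : ¬ Disjoint Z' Z) :
    (Z'.sup fun z => torusDist x z.1) ≤ (Z.sup fun z => torusDist x z.1) + torusDiam Z' := by
  obtain ⟨z₀, hz₀', hz₀⟩ := Finset.not_disjoint_iff.1 h
  refine Finset.sup_le fun z hz => ?_
  calc torusDist x z.1 ≤ torusDist x z₀.1 + torusDist z₀.1 z.1 := torusDist_triangle_holds x z₀.1 z.1
    _ ≤ (Z.sup fun z => torusDist x z.1) + torusDiam Z' :=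
        add_le_add (torusDist_le_sup_of_mem x hz₀) (torusDist_le_torusDiam hz₀' hz)

/-! ### The Lieb–Robinson grading of a ball inside a larger ball -/

omit [DecidableEq κ] in
/-- **Grading axiom 1**: regions of positive grade lie inside the outer ball `B_x(r + ℓ)`, hence
are disjoint from everything supported outside it. [folklore] -/
theorem disjoint_of_grading_pos (x : TorusSite d L) (r ℓ r₀ : ℕ) {Z : Finset (TorusSite d L × κ)}
    (h : 0 < (r + ℓ + 1 - Z.sup fun z => torusDist x z.1) / (r₀ + 1)) {Y : Finset (TorusSite d L × κ)}
    (hY : Disjoint (cellBall x (r + ℓ)) Y) : Disjoint Z Y := by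
  have h1 : r₀ + 1 ≤ r + ℓ + 1 - Z.sup fun z => torusDist x z.1 := by
    by_contra hlt
    rw [not_le] at hlt
    rw [Nat.div_eq_of_lt hlt] at h
    exact lt_irrefl 0 h
  have h2 : (Z.sup fun z => torusDist x z.1) ≤ r + ℓ := by omega
  exact Finset.disjoint_of_subset_left (subset_cellBall_of_sup_le x h2) hY

omit [Fintype κ] [DecidableEq κ] in
/-- **Grading axiom 2**: an interaction term of diameter `≤ r₀` meeting `Z` has grade at least
`grade(Z) − 1`. [folklore] -/
theorem grading_le_grading_add_one (x : TorusSite d L) (r ℓ r₀ : ℕ)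
    {Z Z' : Finset (TorusSite d L × κ)} (hdiam : torusDiam Z' ≤ r₀) (hZZ' : ¬ Disjoint Z' Z) :
    (r + ℓ + 1 - Z.sup fun z => torusDist x z.1) / (r₀ + 1) ≤
      (r + ℓ + 1 - Z'.sup fun z => torusDist x z.1) / (r₀ + 1) + 1 := by
  have h1 := sup_torusDist_le_of_not_disjoint x hZZ'
  have h2 : (r + ℓ + 1 - Z.sup fun z => torusDist x z.1) ≤
      (r + ℓ + 1 - Z'.sup fun z => torusDist x z.1) + (r₀ + 1) := by omega
  calc (r + ℓ + 1 - Z.sup fun z => torusDist x z.1) / (r₀ + 1)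
      ≤ ((r + ℓ + 1 - Z'.sup fun z => torusDist x z.1) + (r₀ + 1)) / (r₀ + 1) :=
        Nat.div_le_div_right h2
    _ = (r + ℓ + 1 - Z'.sup fun z => torusDist x z.1) / (r₀ + 1) + 1 :=
        Nat.add_div_right _ (Nat.succ_pos r₀)

omit [DecidableEq κ] in
/-- **The inner ball has grade `≥ (ℓ + 1)/(r₀ + 1)`.** [folklore] -/
theorem div_le_grading_cellBall (x : TorusSite d L) (r ℓ r₀ : ℕ) :
    (ℓ + 1) / (r₀ + 1) ≤
      (r + ℓ + 1 - (cellBall x r : Finset (TorusSite d L × κ)).sup fun z => torusDist x z.1) /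
        (r₀ + 1) := by
  have h := sup_torusDist_cellBall_le (κ := κ) x r
  exact Nat.div_le_div_right (by omega)

/-! ### The Lieb–Robinson bound between a ball and the outside of a larger ball -/

/-- **Lieb–Robinson bound on the decorated torus, ball versus complement of a larger ball.** For a
finite-range (`diam ≤ r₀`) local interaction `Φ` with `Σ_{Z ∋ y} ‖Φ(Z)‖ ≤ J` and term sizes `≤ V`,
an observable `A` on the ball `B_x(r)` and an observable `B` supported outside `B_x(r + ℓ)` with
`ℓ ≥ r₀`:
`‖[τ_t(A), B]‖ ≤ 2‖A‖‖B‖ (|B_x(r)|/V) exp(−μ ⌊(ℓ+1)/(r₀+1)⌋ + 2e^μ V J |t|)` for every `μ ≥ 0`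
(`norm_comm_heisenbergEvolution_le_exp` with the grading
`Z ↦ ⌊(r + ℓ + 1 − ρ_x(Z))/(r₀ + 1)⌋`). MZ13 §5.1 (the Lieb–Robinson input of Lemma 1 (iv) and
Lemma 2). [folklore] -/
theorem norm_comm_heisenbergEvolution_ball_le {Φ : Interaction (TorusSite d L × κ) q}
    (hΦ : Φ.IsLocal) {r₀ : ℕ} (hrange : ∀ Z, r₀ < torusDiam Z → Φ Z = 0)
    {J : ℝ} (hJ0 : 0 ≤ J)
    (hJ : ∀ y : TorusSite d L × κ, ∑ Z ∈ univ.filter (fun Z : Finset (TorusSite d L × κ) => y ∈ Z),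
      ‖Φ Z‖ ≤ J)
    {V : ℕ} (hV1 : 1 ≤ V) (hV : ∀ Z, Φ Z ≠ 0 → #Z ≤ V)
    (x : TorusSite d L) {r ℓ : ℕ} (hℓ : r₀ ≤ ℓ) {A B : Op (TorusSite d L × κ) q}
    (hA : IsSupportedOn A (cellBall x r)) {Y : Finset (TorusSite d L × κ)}
    (hY : Disjoint (cellBall x (r + ℓ)) Y) (hB : IsSupportedOn B Y) {μ : ℝ} (hμ : 0 ≤ μ) (t : ℝ) :
    ‖heisenbergEvolution (localHamiltonian Φ univ) t A * B -
        B * heisenbergEvolution (localHamiltonian Φ univ) t A‖ ≤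
      2 * ‖A‖ * ‖B‖ * (#(cellBall x r : Finset (TorusSite d L × κ)) / V) *
        Real.exp (-(μ * (((ℓ + 1) / (r₀ + 1) : ℕ) : ℝ)) + 2 * Real.exp μ * V * J * |t|) := by
  set δ : Finset (TorusSite d L × κ) → ℕ := fun Z =>
    (r + ℓ + 1 - Z.sup fun z => torusDist x z.1) / (r₀ + 1) with hδ
  have hδY : ∀ Z, 0 < δ Z → Disjoint Z Y := fun Z hZ => disjoint_of_grading_pos x r ℓ r₀ hZ hY
  have hδstep : ∀ Z Z', Φ Z' ≠ 0 → ¬ Disjoint Z' Z → δ Z ≤ δ Z' + 1 := by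
    intro Z Z' hZ' hZZ'
    have hdiam : torusDiam Z' ≤ r₀ := by
      by_contra h
      exact hZ' (hrange Z' (not_le.mp h))
    exact grading_le_grading_add_one x r ℓ r₀ hdiam hZZ'
  have hX : 0 < δ (cellBall x r) := by
    have h1 := div_le_grading_cellBall (κ := κ) x r ℓ r₀
    have h2 : 0 < (ℓ + 1) / (r₀ + 1) := Nat.div_pos (by omega) (Nat.succ_pos r₀)
    exact lt_of_lt_of_le h2 h1
  have hmain := norm_comm_heisenbergEvolution_le_exp hΦ hA hB δ hδY hδstep hX hJ0 hJ hV1 hV hμ t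
  refine hmain.trans (mul_le_mul_of_nonneg_left (Real.exp_le_exp.mpr ?_) (by positivity))
  have h1 := div_le_grading_cellBall (κ := κ) x r ℓ r₀
  have h2 : (((ℓ + 1) / (r₀ + 1) : ℕ) : ℝ) ≤ (δ (cellBall x r) : ℝ) := by exact_mod_cast h1
  nlinarith

end Literature.MathematicalPhysics.QuantumLattice
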